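import Summits.BirchSwinnertonDyer.BirchSwinnertonDyer.Theorems.TwoAdicConverseRankZeroKolyvaginBigImage
import Summits.BirchSwinnertonDyer.BirchSwinnertonDyer.Theorems.TwoAdicConverseGoodTwistsGoldfeld
import Summits.BirchSwinnertonDyer.BirchSwinnertonDyer.Theorems.ToricSheddingUBPotentiallyGoodStubTwistAdmissible
import Literature.NumberTheory.EllipticCurves.TorsionStructureProofs
import Literature.NumberTheory.EllipticCurves.ExceptionalPrimesDensityModels
import HarnessLib

/-!
# Route `TwoAdicConverse` (rung S3): the «a.e.-twist» rank statement for EVERY non-CM curve good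
# ordinary at `2` WITH SURJECTIVE `2`-ADIC IMAGE, from Kolyvagin at `2` — no class anchor, no tower
# certificate, no main conjecture

Cell `bsd-2adic` (run/shared/lean/pub/bsd-2adic/), seat `bsd-2adic-conv-1` GEN 17, file F2 (companion of
`TwoAdicConverseRankZeroKolyvaginBigImage`, p607060). THEOREMS ONLY — no named fact, no axiom, no
definition; every deep input is a named fact of the tree or an OPEN route decl, carried as an explicit
hypothesis.

**§0 The habitat is twist-stable (kernel theorems, no hypothesis).** For an elliptic `W/ℚ`, `d ≠ 0`
and EVERY level `m ≥ 1`: `ρ̄_{W,m}` onto `Aut(W[m])` ⟹ `ρ̄_{W^{(d)},m}` onto, and the same for any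
model `C • W' = W^{(d)}` (`hasSurjectiveModNGaloisRep_quadraticTwist`,
`forall_hasSurjectiveModNGaloisRep_two_pow_of_smul_eq_quadraticTwist`). Mechanism (Serre 1972 §4 /
Silverman X.5): `W^{(d)}(ℚ̄) ≃ W(ℚ̄)` equivariantly up to the sign `σ√d/√d`
(`exists_addEquiv_geomPoints_quadraticTwist_signed`), so `ρ̄_{W^{(d)},m} ≅ ρ̄_{W,m} ⊗ χ_d`; and
`−1 = J²` is a SQUARE in `Aut(W[m]) ≅ GL₂(ℤ/m)` (`J` = the quarter turn in a frame
`W[m] ≅ (ℤ/m)²`, Silverman III.6.4(b) = `nonempty_geomTorsion_addEquiv_fin_two`), so the twisted image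
contains `−1` and hence everything (`twistAdmissible_surjective_toAddAut_of_signEquivariant`, the
tree's general group-theory lemma — there for a prime level, here for every level). In particular the
BIG-IMAGE habitat «`ρ_{E,2^∞}` onto» (`∀ m, ρ̄_{E,2^m}` onto) is closed under ALL quadratic twists,
hence under the good family `𝓕 = {d square-free, d ≡ 1 (mod 4)}` together with «non-CM, good
ordinary at `2`» (`TwoAdicGoodTwists.not_hasCM_and_goodOrd_of_smul_eq_quadraticTwist`).

**§1–§2 Consequence.** F1 (`TwoAdicKolyvaginRankZero.nonCMTwoConverse_bigImage_of_kolyvaginAtTwo`)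
gives the whole rung leaf (`r ≤ 1`) on the habitat from the `r = 1` residual's cruxes V1′
(`KolyvaginNonvanishingAtTwoFrame`, item 24622) + V2♭ (`KolyvaginCorankLowerBoundAtTwo`, item
24623) + PRINT (item 23951 `PrintedInputsRankOneAtTwo`, BFH, GZK; `NoTwoTorsionOverK` = item 24405,
proved). Since the habitat is twist-stable, the leaf holds at EVERY good twist of a big-image `W`,
and Smith's Thm. 1.1 for `W` turns it into LADDER-BSD §1 row S3's head line for `W`:
`bsdRank_and_goldfeld_goodTwists_bigImage_of_kolyvaginAtTwo` — for every globally minimal non-CM `W`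
good ordinary at `2` with surjective `2`-adic image, rank BSD (`ord_{s=1} L = rank`, `Ш` finite) for
`100 %` of `d ∈ 𝓕` and Goldfeld's `50 / 50` with BSD in `𝓕`, from V1′ + V2♭ + PRINT + Smith — with
NO cyclotomic input (no λ/μ, no crux 19556), NO class anchor and NO tower certificate (contrast: the
611-class census rows of GEN 9–16 need a certified tower row per class and reach only `r = 0`).

HONEST FRAMING. Nothing here proves the cruxes, the leaf or BSD: V1′ / V2♭ are OPEN at `p = 2`
(printed for `p ≥ 5`: W. Zhang 2014, Kolyvagin 1991, BCGS 2026); Smith 2025 Thm. 1.1, BFH 1990,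
Hoffstein–Luo 1997, `2`-parity, GZK, Kato/Kolyvagin finiteness, Gross–Zagier over `K`, Shimura
reciprocity and modularity are named PRINT facts taken as hypotheses. Says nothing about
`d ≢ 1 (mod 4)` (additive `2`) nor about curves OFF the habitat (rational `2`-torsion / `2`-isogeny /
a proper Rouse–Zureick-Brown image: items 24404 and its `r = 0` twin). PARTITION (D-0054): none —
RANK axis (S3); companion formula cell X5@2 good-ord (B1·O1; class = every non-CM `E/ℚ` good
ordinary at `2` with surjective `2`-adic image — the generic curve). BSD is not proved by any of this.

References: J.-P. Serre, Invent. Math. 15 (1972), §4 [Serre1972]; J. H. Silverman, *AEC* (2009),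
III.6.4(b), X.2 Prop. 2.4, X.5 Cor. 5.4 [SilvermanAEC2009]; J. Rouse, D. Zureick-Brown, arXiv:1402.5997,
Remark 1.6 (twists and `−I`) [RouseZureickbrown2015]; A. Smith, arXiv:2503.17619, Thm. 1.1, Cor. 1.2–1.3
[arXiv250317619]; W. Zhang, Camb. J. Math. 2 (2014), Thm. 1.1 [WZhang2014]; D. Bump, S. Friedberg,
J. Hoffstein, Invent. Math. 102 (1990) [BumpFriedbergHoffstein1990]; M. R. Murty, V. K. Murty (1997),
Ch. 6 §1 [MurtyMurty1997].
-/

set_option linter.dupNamespace false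
set_option autoImplicit false

noncomputable section

open scoped Classical

open Filter Topology WeierstrassCurve Literature Literature.NumberTheory.EllipticCurves
  Literature.NumberTheory.EllipticCurves.ModularForms
  Literature.NumberTheory.EllipticCurves.Rank1Residual
  Summit.BirchSwinnertonDyer.BirchSwinnertonDyer.Theses.TwoAdicConverse
  Summit.BirchSwinnertonDyer.BirchSwinnertonDyer.Theorems.GoldfeldGoodTwists
  Summit.BirchSwinnertonDyer.BirchSwinnertonDyer.Theorems.TwoAdicGoodTwists
  Summit.BirchSwinnertonDyer.BirchSwinnertonDyer.Theorems.TwoAdicKolyvaginRankZero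

namespace Summit.BirchSwinnertonDyer.BirchSwinnertonDyer.Theorems.TwoAdicKolyvaginGoodTwists

/-! ## §0 Surjectivity of `ρ̄_{E,m}` is stable under quadratic twists, at EVERY level `m` -/

section TwistStable

/-- **`−1` is a square in `Aut(E[m])` for every level `m ≥ 1`**: for an elliptic `W/ℚ` there is an
additive automorphism `g` of `E[m] = E(ℚ̄)[m]` with `g ∘ g = −1` — the quarter turn `(0 −1; 1 0)` in
a frame `E[m] ≅ (ℤ/m)²` (Silverman *AEC* III.6.4(b), tree theorem
`nonempty_geomTorsion_addEquiv_fin_two`). The tree's `twistAdmissible_exists_sq_eq_neg` is the prime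
level case. [cite: SilvermanAEC2009, Cor. III.6.4(b)] -/
theorem exists_sq_eq_neg_geomTorsion (W : WeierstrassCurve ℚ) [W.IsElliptic] {m : ℕ} (hm : m ≠ 0) :
    ∃ g : geomTorsion W m ≃+ geomTorsion W m, ∀ P, g (g P) = -P := by
  obtain ⟨e⟩ := W.nonempty_geomTorsion_addEquiv_fin_two (m := m) (by exact_mod_cast hm)
  obtain ⟨J, hJ⟩ := twistAdmissible_exists_quarterTurn (ZMod m)
  refine ⟨e.trans (J.trans e.symm), fun P ↦ ?_⟩
  simp only [AddEquiv.trans_apply, AddEquiv.apply_symm_apply, hJ, map_neg,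
    AddEquiv.symm_apply_apply]

/-- **Surjectivity of `ρ̄_{E,m}` through a sign-twisted isomorphism of curves, every level `m ≥ 1`.**
If `f : E₁(ℚ̄) ≃+ E₂(ℚ̄)` is, for every `σ ∈ Γ_ℚ`, either equivariant or anti-equivariant at `σ`
(`f(σP) = ±σ f(P)`), then `ρ̄_{E₂,m}` onto implies `ρ̄_{E₁,m}` onto (`E₂` elliptic): restrict `f` to
`E₁[m] ≃+ E₂[m]` (`torsionByEquiv`) and apply the tree's
`twistAdmissible_surjective_toAddAut_of_signEquivariant` with `−1 = g ∘ g` in `Aut(E₂[m])`.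
[cite: Serre1972, §4] -/
theorem hasSurjectiveModNGaloisRep_of_addEquiv_signed_level
    {W₁ W₂ : WeierstrassCurve ℚ} [W₂.IsElliptic] (f : geomPoints W₁ ≃+ geomPoints W₂)
    (hf : ∀ σ : Field.absoluteGaloisGroup ℚ,
      (∀ P, f (σ • P) = σ • f P) ∨ (∀ P, f (σ • P) = -(σ • f P)))
    {m : ℕ} (hm : m ≠ 0) (h : W₂.HasSurjectiveModNGaloisRep m) :
    W₁.HasSurjectiveModNGaloisRep m := by
  obtain ⟨g, hg⟩ := exists_sq_eq_neg_geomTorsion W₂ hm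
  let e : geomTorsion W₁ m ≃+ geomTorsion W₂ m := torsionByEquiv f m
  have he : ∀ P : geomTorsion W₁ m, ((e P : geomTorsion W₂ m) : geomPoints W₂) = f P :=
    fun _ ↦ rfl
  refine twistAdmissible_surjective_toAddAut_of_signEquivariant e (fun σ ↦ ?_) g hg h
  rcases hf σ with hs | hs
  · left
    intro P
    apply Subtype.ext
    rw [he, AddSubgroup.torsionBy.coe_smul, hs, AddSubgroup.torsionBy.coe_smul, he]
  · right
    intro P
    apply Subtype.ext
    rw [he, AddSubgroup.torsionBy.coe_smul, hs, AddSubgroup.coe_neg,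
      AddSubgroup.torsionBy.coe_smul, he]

/-- **`ρ̄_{E^{(d)},m}` onto from `ρ̄_{E,m}` onto, every level `m ≥ 1`** (`d ≠ 0`):
`E^{(d)}(ℚ̄) ≃+ E(ℚ̄)` is equivariant up to the sign `σ√d/√d`
(`exists_addEquiv_geomPoints_quadraticTwist_signed`; `ρ̄_{E^{(d)},m} ≅ ρ̄_{E,m} ⊗ χ_d`), and the
twisted image contains `−1 = J²`, hence all of `Aut(E^{(d)}[m])` (Rouse–Zureick-Brown 2015, Rem. 1.6:
twisting moves the image only inside `±H`). [cite: SilvermanAEC2009, X.5 Cor. 5.4 and X.2 Prop. 2.4]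
[cite: RouseZureickbrown2015, Remark 1.6] -/
theorem hasSurjectiveModNGaloisRep_quadraticTwist (W : WeierstrassCurve ℚ) [W.IsElliptic]
    {d : ℚ} (hd : d ≠ 0) {m : ℕ} (hm : m ≠ 0) (h : W.HasSurjectiveModNGaloisRep m) :
    (W.quadraticTwist d).HasSurjectiveModNGaloisRep m := by
  obtain ⟨f, hf⟩ := W.exists_addEquiv_geomPoints_quadraticTwist_signed hd
  exact hasSurjectiveModNGaloisRep_of_addEquiv_signed_level f hf hm h

/-- **The big-image habitat is closed under quadratic twists, on every model**: if `ρ̄_{W,2^m}` is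
onto for all `m` and `C • W' = W^{(d)}` (`d ≠ 0`), then `ρ̄_{W',2^m}` is onto for all `m`
(`hasSurjectiveModNGaloisRep_quadraticTwist` + model-independence `hasSurjectiveModNGaloisRep_smul_iff`).
[cite: RouseZureickbrown2015, Remark 1.6] [cite: SilvermanAEC2009, X.5 Cor. 5.4] -/
theorem forall_hasSurjectiveModNGaloisRep_two_pow_of_smul_eq_quadraticTwist
    (W W' : WeierstrassCurve ℚ) [W.IsElliptic] {d : ℚ} (hd : d ≠ 0) {C : VariableChange ℚ}
    (hC : C • W' = W.quadraticTwist d)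
    (hsur : ∀ m : ℕ, W.HasSurjectiveModNGaloisRep (2 ^ m : ℕ)) :
    ∀ m : ℕ, W'.HasSurjectiveModNGaloisRep (2 ^ m : ℕ) := by
  intro m
  have h := hasSurjectiveModNGaloisRep_quadraticTwist W hd (m := 2 ^ m) (pow_ne_zero m two_ne_zero)
    (hsur m)
  rw [← hC] at h
  exact (hasSurjectiveModNGaloisRep_smul_iff W' C _).mp h

end TwistStable

/-! ## §1 One good twist of a big-image curve: rank BSD at Selmer corank `≤ 1` -/

section OneTwist

/-- **Rank BSD for one good twist of a BIG-IMAGE curve, Selmer corank `≤ 1`, from Kolyvagin at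
`2`.** For `W/ℚ` globally minimal, non-CM, good ordinary at `2`, with `ρ̄_{W,2^m}` onto for all `m`,
and `d ≡ 1 (mod 4)` with `r := corank_{ℤ₂} Sel_{2^∞}(W^{(d)}/ℚ) ≤ 1`:
`ord_{s=1} L(W^{(d)}, s) = rank W^{(d)}(ℚ) = r` and `Ш(W^{(d)}/ℚ)` is finite. Transport to a minimal
model `W'` of `W^{(d)}` — again non-CM, good ordinary at `2`
(`not_hasCM_and_goodOrd_of_smul_eq_quadraticTwist`) AND big-image (§0) — then F1's leaf on the
habitat (`nonCMTwoConverse_bigImage_of_kolyvaginAtTwo`: V1′ + V2♭ + `NoTwoTorsionOverK` +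
`PrintedInputsRankOneAtTwo` + BFH + GZK) and GZK for rank and `Ш`.
[cite: arXiv250317619, §1 (the p-converse input of Cor. 1.2)] [cite: WZhang2014, Thm. 1.1 (shape)] -/
theorem bsdRank_quadraticTwist_of_selmerCorankTwoInfty_le_one_bigImage
    (hV1 : KolyvaginNonvanishingAtTwoFrame) (hV2 : KolyvaginCorankLowerBoundAtTwo)
    (hT : NoTwoTorsionOverK) (hIn : PrintedInputsRankOneAtTwo)
    (hBFH : bumpFriedbergHoffstein_exists_heegnerField_split_twist_simpleZero)
    (hGZK : rank_eq_analyticRank_of_analyticRank_le_one)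
    (W : WeierstrassCurve ℚ) [W.IsElliptic] [W.IsGloballyMinimal] (hCM : ¬ W.HasCM)
    (hgo : GoodOrd W 2) (hsur : ∀ m : ℕ, W.HasSurjectiveModNGaloisRep (2 ^ m : ℕ))
    {d : ℤ} (hd4 : d % 4 = 1) (hle : selmerCorankTwoInfty (W.quadraticTwist d) ≤ 1) :
    (W.quadraticTwist d).analyticRank = selmerCorankTwoInfty (W.quadraticTwist d) ∧
      (W.quadraticTwist d).mordellWeilRank = selmerCorankTwoInfty (W.quadraticTwist d) ∧
        Finite (W.quadraticTwist d).sha := by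
  have hd0 : ((d : ℤ) : ℚ) ≠ 0 := by exact_mod_cast (show d ≠ 0 by omega)
  haveI := W.isElliptic_quadraticTwist hd0
  obtain ⟨W', hW'ell, hW'min, C, hC⟩ := exists_isGloballyMinimal_smul_eq_quadraticTwist W hd0
  obtain ⟨hCM', hgo'⟩ := not_hasCM_and_goodOrd_of_smul_eq_quadraticTwist W W' hCM hgo hd4 hC
  have hsur' := forall_hasSurjectiveModNGaloisRep_two_pow_of_smul_eq_quadraticTwist W W' hd0 hC hsur
  have hcor' : W'.selmerCorank 2 = selmerCorankTwoInfty (W.quadraticTwist d) := by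
    rw [selmerCorank_eq_of_variableChange 2 hC, ← selmerCorankTwoInfty_eq]
  have hW'r : W'.analyticRank = selmerCorankTwoInfty (W.quadraticTwist d) :=
    nonCMTwoConverse_bigImage_of_kolyvaginAtTwo hV1 hV2 hT hIn hBFH hGZK W' hCM' (Or.inl hgo')
      hsur' _ hle hcor'
  have har : (W.quadraticTwist (d : ℚ)).analyticRank = selmerCorankTwoInfty (W.quadraticTwist d) := by
    rw [← hW'r, ← hC, analyticRank_smul]
  obtain ⟨hrank, hsha⟩ := hGZK (W.quadraticTwist (d : ℚ)) (by omega)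
  exact ⟨har, by rw [hrank, har], hsha⟩

end OneTwist

/-! ## §2 Rank BSD for `100 %` of `𝓕` and Goldfeld `50 / 50`, for every big-image curve -/

section Density

variable (W : WeierstrassCurve ℚ) [W.IsElliptic] [W.IsGloballyMinimal]

/-- **Rank BSD holds for `100 %` of the good quadratic twists of a big-image curve** (absolute form):
under V1′, V2♭, `NoTwoTorsionOverK`, `PrintedInputsRankOneAtTwo`, BFH, GZK and Smith's Thm. 1.1 for
`W` (non-CM, good ordinary at `2`, `ρ_{W,2^∞}` onto), the square-free `d` with "`d ≡ 1 (mod 4)` ⟹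
`ord_{s=1} L(W^{(d)}, s) = rank W^{(d)}(ℚ) ∧ Ш(W^{(d)}/ℚ)` finite" have density `1`.
[cite: arXiv250317619, Thm. 1.1 and Cor. 1.2] -/
theorem twistDensity_bsdRank_bigImage
    (hV1 : KolyvaginNonvanishingAtTwoFrame) (hV2 : KolyvaginCorankLowerBoundAtTwo)
    (hT : NoTwoTorsionOverK) (hIn : PrintedInputsRankOneAtTwo)
    (hBFH : bumpFriedbergHoffstein_exists_heegnerField_split_twist_simpleZero)
    (hGZK : rank_eq_analyticRank_of_analyticRank_le_one)
    (hCM : ¬ W.HasCM) (hgo : GoodOrd W 2) (hsur : ∀ m : ℕ, W.HasSurjectiveModNGaloisRep (2 ^ m : ℕ))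
    (hS : smith_selmerCorank_density W) :
    twistDensity (fun d ↦ d % 4 = 1 →
      (W.quadraticTwist d).analyticRank = (W.quadraticTwist d).mordellWeilRank ∧
        Finite (W.quadraticTwist d).sha) 1 := by
  refine twistDensity_one_mono (fun d _ hRd hd4 ↦ ?_) (twistDensity_selmerCorankTwoInfty_le_one_of W hS)
  obtain ⟨har, hrank, hsha⟩ := bsdRank_quadraticTwist_of_selmerCorankTwoInfty_le_one_bigImage
    hV1 hV2 hT hIn hBFH hGZK W hCM hgo hsur hd4 hRd.2
  exact ⟨har.trans hrank.symm, hsha⟩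

/-- **Rank BSD for `100 %` of the good twists of a big-image curve** (relative form, with the
corank): for `d ∈ 𝓕` of relative density `1`,
`ord_{s=1} L(W^{(d)}, s) = rank W^{(d)}(ℚ) = corank_{ℤ₂} Sel_{2^∞}(W^{(d)}/ℚ) ≤ 1` and
`Ш(W^{(d)}/ℚ)` is finite. [cite: arXiv250317619, Thm. 1.1 and Cor. 1.2] -/
theorem tendsto_bsdRank_eq_selmerCorankTwoInfty_bigImage
    (hV1 : KolyvaginNonvanishingAtTwoFrame) (hV2 : KolyvaginCorankLowerBoundAtTwo)
    (hT : NoTwoTorsionOverK) (hIn : PrintedInputsRankOneAtTwo)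
    (hBFH : bumpFriedbergHoffstein_exists_heegnerField_split_twist_simpleZero)
    (hGZK : rank_eq_analyticRank_of_analyticRank_le_one)
    (hCM : ¬ W.HasCM) (hgo : GoodOrd W 2) (hsur : ∀ m : ℕ, W.HasSurjectiveModNGaloisRep (2 ^ m : ℕ))
    (hS : smith_selmerCorank_density W) :
    Tendsto (fun X : ℕ ↦ (Nat.card {d : ℤ | Squarefree d ∧ |d| ≤ (X : ℤ) ∧ (d % 4 = 1 ∧
        (selmerCorankTwoInfty (W.quadraticTwist d) ≤ 1 ∧
          (W.quadraticTwist d).analyticRank = selmerCorankTwoInfty (W.quadraticTwist d) ∧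
          (W.quadraticTwist d).mordellWeilRank = selmerCorankTwoInfty (W.quadraticTwist d) ∧
          Finite (W.quadraticTwist d).sha))} : ℝ) /
      Nat.card {d : ℤ | Squarefree d ∧ |d| ≤ (X : ℤ) ∧ d % 4 = 1}) atTop (𝓝 1) := by
  have hR := twistDensity_selmerCorankTwoInfty_le_one_of W hS
  have h0 : twistDensity (fun d ↦ ¬ (d ≠ 0 ∧ selmerCorankTwoInfty (W.quadraticTwist d) ≤ 1)) 0 := by
    simpa using hR.compl
  refine tendsto_familyProportion_one_of_twistDensity_zero (h0.mono_zero fun d _ h hRd ↦ h.2 ?_)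
  exact ⟨hRd.2, bsdRank_quadraticTwist_of_selmerCorankTwoInfty_le_one_bigImage hV1 hV2 hT hIn hBFH
    hGZK W hCM hgo hsur h.1 hRd.2⟩

/-- The headline shape: for `100 %` of `d ∈ 𝓕`, `ord_{s=1} L(W^{(d)}, s) = rank W^{(d)}(ℚ)` and
`Ш(W^{(d)}/ℚ)` is finite, for a big-image `W`. [cite: arXiv250317619, Thm. 1.1 and Cor. 1.2] -/
theorem tendsto_bsdRank_bigImage
    (hV1 : KolyvaginNonvanishingAtTwoFrame) (hV2 : KolyvaginCorankLowerBoundAtTwo)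
    (hT : NoTwoTorsionOverK) (hIn : PrintedInputsRankOneAtTwo)
    (hBFH : bumpFriedbergHoffstein_exists_heegnerField_split_twist_simpleZero)
    (hGZK : rank_eq_analyticRank_of_analyticRank_le_one)
    (hCM : ¬ W.HasCM) (hgo : GoodOrd W 2) (hsur : ∀ m : ℕ, W.HasSurjectiveModNGaloisRep (2 ^ m : ℕ))
    (hS : smith_selmerCorank_density W) :
    Tendsto (fun X : ℕ ↦ (Nat.card {d : ℤ | Squarefree d ∧ |d| ≤ (X : ℤ) ∧ (d % 4 = 1 ∧
        ((W.quadraticTwist d).analyticRank = (W.quadraticTwist d).mordellWeilRank ∧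
          Finite (W.quadraticTwist d).sha))} : ℝ) /
      Nat.card {d : ℤ | Squarefree d ∧ |d| ≤ (X : ℤ) ∧ d % 4 = 1}) atTop (𝓝 1) := by
  have hR := twistDensity_selmerCorankTwoInfty_le_one_of W hS
  have h0 : twistDensity (fun d ↦ ¬ (d ≠ 0 ∧ selmerCorankTwoInfty (W.quadraticTwist d) ≤ 1)) 0 := by
    simpa using hR.compl
  refine tendsto_familyProportion_one_of_twistDensity_zero (h0.mono_zero fun d _ h hRd ↦ h.2 ?_)
  obtain ⟨har, hrank, hsha⟩ := bsdRank_quadraticTwist_of_selmerCorankTwoInfty_le_one_bigImage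
    hV1 hV2 hT hIn hBFH hGZK W hCM hgo hsur h.1 hRd.2
  exact ⟨har.trans hrank.symm, hsha⟩

/-- **Goldfeld, odd half, with BSD, in `𝓕`, for a big-image curve**: among `d ∈ 𝓕`, `|d| ≤ X`, the
proportion with `ord_{s=1} L(W^{(d)}, s) = rank W^{(d)}(ℚ) = 1` and `Ш(W^{(d)}/ℚ)` finite tends to
`1/2` (root numbers equidistribute in `𝓕`: Modularity, the first conjunct of item 23951).
[cite: arXiv250317619, Thm. 1.1 and Cor. 1.2] [cite: MurtyMurty1997, Ch. 6 §1] -/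
theorem tendsto_familyProportion_rankOne_bigImage
    (hV1 : KolyvaginNonvanishingAtTwoFrame) (hV2 : KolyvaginCorankLowerBoundAtTwo)
    (hT : NoTwoTorsionOverK) (hIn : PrintedInputsRankOneAtTwo)
    (hBFH : bumpFriedbergHoffstein_exists_heegnerField_split_twist_simpleZero)
    (hGZK : rank_eq_analyticRank_of_analyticRank_le_one)
    (hCM : ¬ W.HasCM) (hgo : GoodOrd W 2) (hsur : ∀ m : ℕ, W.HasSurjectiveModNGaloisRep (2 ^ m : ℕ))
    (hS : smith_selmerCorank_density W) :
    Tendsto (fun X : ℕ ↦ (Nat.card {d : ℤ | Squarefree d ∧ |d| ≤ (X : ℤ) ∧ (d % 4 = 1 ∧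
        ((W.quadraticTwist d).analyticRank = 1 ∧ (W.quadraticTwist d).mordellWeilRank = 1 ∧
          Finite (W.quadraticTwist d).sha))} : ℝ) /
      Nat.card {d : ℤ | Squarefree d ∧ |d| ≤ (X : ℤ) ∧ d % 4 = 1}) atTop (𝓝 (1 / 2)) := by
  have hmod : exists_isNewformOf := hIn.1
  refine tendsto_familyProportion_of_congr_one
    (tendsto_familyProportion_rootNumber_eq_neg_one W hmod)
    (tendsto_bsdRank_eq_selmerCorankTwoInfty_bigImage W hV1 hV2 hT hIn hBFH hGZK hCM hgo hsur hS)
    fun d hd _ hR ↦ ?_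
  obtain ⟨hle, hra, hrk, hsha⟩ := hR
  haveI := W.isElliptic_quadraticTwist (d := (d : ℚ)) (by exact_mod_cast hd.ne_zero)
  rw [rootNumber_eq_neg_one_iff_analyticRank_eq_one hmod _ (hra ▸ hle)]
  constructor
  · intro h1; exact ⟨h1, by rw [hrk, ← hra, h1], hsha⟩
  · exact fun h ↦ h.1

/-- **Goldfeld, even half, with BSD, in `𝓕`, for a big-image curve**: the proportion of `d ∈ 𝓕`,
`|d| ≤ X`, with `ord_{s=1} L(W^{(d)}, s) = rank W^{(d)}(ℚ) = 0` and `Ш(W^{(d)}/ℚ)` finite tends to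
`1/2`. [cite: arXiv250317619, Thm. 1.1 and Cor. 1.2] [cite: MurtyMurty1997, Ch. 6 §1] -/
theorem tendsto_familyProportion_rankZero_bigImage
    (hV1 : KolyvaginNonvanishingAtTwoFrame) (hV2 : KolyvaginCorankLowerBoundAtTwo)
    (hT : NoTwoTorsionOverK) (hIn : PrintedInputsRankOneAtTwo)
    (hBFH : bumpFriedbergHoffstein_exists_heegnerField_split_twist_simpleZero)
    (hGZK : rank_eq_analyticRank_of_analyticRank_le_one)
    (hCM : ¬ W.HasCM) (hgo : GoodOrd W 2) (hsur : ∀ m : ℕ, W.HasSurjectiveModNGaloisRep (2 ^ m : ℕ))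
    (hS : smith_selmerCorank_density W) :
    Tendsto (fun X : ℕ ↦ (Nat.card {d : ℤ | Squarefree d ∧ |d| ≤ (X : ℤ) ∧ (d % 4 = 1 ∧
        ((W.quadraticTwist d).analyticRank = 0 ∧ (W.quadraticTwist d).mordellWeilRank = 0 ∧
          Finite (W.quadraticTwist d).sha))} : ℝ) /
      Nat.card {d : ℤ | Squarefree d ∧ |d| ≤ (X : ℤ) ∧ d % 4 = 1}) atTop (𝓝 (1 / 2)) := by
  have hmod : exists_isNewformOf := hIn.1
  refine tendsto_familyProportion_of_congr_one (tendsto_familyProportion_rootNumber_eq_one W hmod)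
    (tendsto_bsdRank_eq_selmerCorankTwoInfty_bigImage W hV1 hV2 hT hIn hBFH hGZK hCM hgo hsur hS)
    fun d hd _ hR ↦ ?_
  obtain ⟨hle, hra, hrk, hsha⟩ := hR
  haveI := W.isElliptic_quadraticTwist (d := (d : ℚ)) (by exact_mod_cast hd.ne_zero)
  rw [rootNumber_eq_one_iff_analyticRank_eq_zero hmod _ (hra ▸ hle)]
  constructor
  · intro h0; exact ⟨h0, by rw [hrk, ← hra, h0], hsha⟩
  · exact fun h ↦ h.1

/-- **LADDER-BSD §1 row S3's head line for EVERY big-image curve, from Kolyvagin at `2`.** For every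
globally minimal NON-CM `W/ℚ` good ORDINARY at `2` with SURJECTIVE `2`-adic image: rank BSD
(`ord_{s=1} L(W^{(d)}, s) = rank W^{(d)}(ℚ)`, `Ш(W^{(d)}/ℚ)` finite) for `100 %` of the good twists
`d ∈ 𝓕`, and Goldfeld's `50 / 50` with BSD in `𝓕` — from V1′ (item 24622) + V2♭ (item 24623) +
`NoTwoTorsionOverK` (item 24405, proved) + `PrintedInputsRankOneAtTwo` (item 23951) + BFH + GZK +
Smith's Thm. 1.1 for `W`. Compare `TwoAdicGoodTwists.bsdRank_and_goldfeld_goodTwists_of_nonCMTwoConverse`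
(the same conclusion from the whole leaf): on the habitat the leaf is not needed beyond the two
Kolyvagin-at-`2` cruxes. [cite: arXiv250317619, Thm. 1.1 and Cor. 1.2] [cite: WZhang2014, Thm. 1.1 (shape)]
[cite: MurtyMurty1997, Ch. 6 §1] -/
theorem bsdRank_and_goldfeld_goodTwists_bigImage_of_kolyvaginAtTwo
    (hV1 : KolyvaginNonvanishingAtTwoFrame) (hV2 : KolyvaginCorankLowerBoundAtTwo)
    (hT : NoTwoTorsionOverK) (hIn : PrintedInputsRankOneAtTwo)
    (hBFH : bumpFriedbergHoffstein_exists_heegnerField_split_twist_simpleZero)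
    (hGZK : rank_eq_analyticRank_of_analyticRank_le_one)
    (hCM : ¬ W.HasCM) (hgo : GoodOrd W 2) (hsur : ∀ m : ℕ, W.HasSurjectiveModNGaloisRep (2 ^ m : ℕ))
    (hS : smith_selmerCorank_density W) :
    Tendsto (fun X : ℕ ↦ (Nat.card {d : ℤ | Squarefree d ∧ |d| ≤ (X : ℤ) ∧ (d % 4 = 1 ∧
        ((W.quadraticTwist d).analyticRank = (W.quadraticTwist d).mordellWeilRank ∧
          Finite (W.quadraticTwist d).sha))} : ℝ) /
      Nat.card {d : ℤ | Squarefree d ∧ |d| ≤ (X : ℤ) ∧ d % 4 = 1}) atTop (𝓝 1) ∧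
    Tendsto (fun X : ℕ ↦ (Nat.card {d : ℤ | Squarefree d ∧ |d| ≤ (X : ℤ) ∧ (d % 4 = 1 ∧
        ((W.quadraticTwist d).analyticRank = 0 ∧ (W.quadraticTwist d).mordellWeilRank = 0 ∧
          Finite (W.quadraticTwist d).sha))} : ℝ) /
      Nat.card {d : ℤ | Squarefree d ∧ |d| ≤ (X : ℤ) ∧ d % 4 = 1}) atTop (𝓝 (1 / 2)) ∧
    Tendsto (fun X : ℕ ↦ (Nat.card {d : ℤ | Squarefree d ∧ |d| ≤ (X : ℤ) ∧ (d % 4 = 1 ∧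
        ((W.quadraticTwist d).analyticRank = 1 ∧ (W.quadraticTwist d).mordellWeilRank = 1 ∧
          Finite (W.quadraticTwist d).sha))} : ℝ) /
      Nat.card {d : ℤ | Squarefree d ∧ |d| ≤ (X : ℤ) ∧ d % 4 = 1}) atTop (𝓝 (1 / 2)) :=
  ⟨tendsto_bsdRank_bigImage W hV1 hV2 hT hIn hBFH hGZK hCM hgo hsur hS,
    tendsto_familyProportion_rankZero_bigImage W hV1 hV2 hT hIn hBFH hGZK hCM hgo hsur hS,
    tendsto_familyProportion_rankOne_bigImage W hV1 hV2 hT hIn hBFH hGZK hCM hgo hsur hS⟩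

end Density

end Summit.BirchSwinnertonDyer.BirchSwinnertonDyer.Theorems.TwoAdicKolyvaginGoodTwists

end
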